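import Literature.AlgebraicGeometry.HodgeTheory.PicardLefschetzNodalForms
import Mathlib.LinearAlgebra.Trace
import HarnessLib

/-!
# Non-commutation of two monodromies from their traces (a Picard–Lefschetz transvection commuting with `T₂`
# does not change the trace of `T₂`)

Family `hodge`, layer `Literature/AlgebraicGeometry/HodgeTheory`; theorems only (no definition, no named fact). Written by
the prover seat `hodge-nonav-prover-Bx` (g16, cell `hodge-nonav`) as brick B1 of the programme «A₃-TRACE» for the binder
hN `SymmetricA3NonCommutation` (`stub_a3NonComm`: the transports along the two circles of the symmetric `A₃` unfolding
do not commute) of crux K1-B `VeryGeneralSignCommutatorsInHg` (`Summits/HodgeConjecture/HodgeConjecture/Theses/SignSymmetricPowers.lean`,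
stmt-HodgeConjecture-19716). The programme proves hN WITHOUT intersection numbers of vanishing cycles: the traces of
`T₁`, `T₂` are read off the Picard–Lefschetz formulas, the trace of `T₁T₂` is the LOCALISED LEFSCHETZ TRACE of the
monodromy around the `A₃` point (`SingularHomology/HomologySelfMapFixingOpenSetTrace`), and the present file turns the
trace discrepancy into non-commutation.

* §1 (linear algebra over a field) `trace_mul_eq_zero_of_commute_of_rankOne` — if `N₁ x = φ(x) v` with `φ(v) = 0`
  (a square-zero rank-`≤ 1` endomorphism, e.g. `T₁ − 1` for a symplectic transvection) commutes with `T₂`, then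
  `tr(N₁ T₂) = 0`, so `tr(T₁ T₂) = tr(T₂)` (`trace_mul_eq_trace_of_commute_of_transvection`); and the reflection
  analogue `trace_mul_eq_or_of_commute_of_reflection`: if `N₁ x = c·B(x, v) v` with `c·B(v, v) = −2` commutes with a
  `B`-isometry `T₂`, then `tr(N₁ T₂) ∈ {2, −2}` (`T₂ v = ±v`).
* §2 (the universal family) `IsPicardLefschetzData.trans_ne_trans_of_odd_of_trace_ne` — for ODD fibre dimension `n`,
  one-nodal Picard–Lefschetz data along `γ₁` and THE transports `T₁` (along `γ₁`) and `T₂` (any):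
  **`tr(T₁ ≫ T₂) ≠ tr(T₂) ⟹ T₁ ≫ T₂ ≠ T₂ ≫ T₁`**; `IsPicardLefschetzData.trans_ne_trans_of_even_of_trace_ne` — for EVEN
  `n` and `T₂` an isometry of `B = tr ∘ ∪`: `tr(T₁ ≫ T₂) − tr(T₂) ∉ {2, −2} ⟹ T₁ ≫ T₂ ≠ T₂ ≫ T₁`.

Voisin II §3.2.1 (Thm. 3.16: `T(α) = α ± ⟨α, δ⟩ δ`; Cor. 3.17: `⟨δ, δ⟩ = 0` for odd `n`, `= ∓2` for even `n`); the trace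
bookkeeping is elementary linear algebra. Nothing here proves hN or HC; rung F-H1 not moved.

## References

* [VoisinHodgeII2003] C. Voisin, Hodge Theory and Complex Algebraic Geometry II, CUP 2003, §3.2.1 Thm. 3.16, Cor. 3.17,
  Rem. 3.21.
* [ArnoldGuseinzadeVarchenko2012] V. I. Arnold, S. M. Gusein-Zade, A. N. Varchenko, Singularities of Differentiable Maps II,
  Part I §1.3 (Picard–Lefschetz formula), §2.3.
-/

noncomputable section

open CategoryTheory AlgebraicGeometry
open Literature.AlgebraicTopology.SingularHomology
open Literature.AlgebraicGeometry.Motives Literature.AlgebraicGeometry.Motives.UniversalHypersurface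

namespace Literature.AlgebraicGeometry.HodgeTheory

/-! ### §1 Linear algebra: a commuting transvection / reflection and the trace -/

section LinearAlgebra

variable {K : Type*} [Field K] {V : Type*} [AddCommGroup V] [Module K V] [FiniteDimensional K V]

/-- **A square-zero rank-one endomorphism commuting with `T₂` has `tr(N₁ T₂) = 0`.** If `N₁ x = φ(x) • v` with
`φ(v) = 0` and `N₁ T₂ = T₂ N₁`, then `N₁ T₂ = φ(T₂ ·) • v` has trace `φ(T₂ v)`, and `φ(T₂ v) • v = N₁ T₂ v = T₂ N₁ v = 0`.
[cite: VoisinHodgeII2003, §3.2.1 Thm. 3.16 and Cor. 3.17] -/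
theorem trace_mul_eq_zero_of_commute_of_rankOne (N₁ T₂ : Module.End K V) (φ : Module.Dual K V) (v : V)
    (hN : ∀ x, N₁ x = φ x • v) (hφ : φ v = 0) (hcomm : N₁ * T₂ = T₂ * N₁) :
    LinearMap.trace K V (N₁ * T₂) = 0 := by
  have hprod : N₁ * T₂ = (φ ∘ₗ T₂).smulRight v := by
    refine LinearMap.ext fun x => ?_
    rw [Module.End.mul_apply, hN, LinearMap.smulRight_apply, LinearMap.comp_apply]
  have hv : φ (T₂ v) • v = 0 := by
    have h1 : (N₁ * T₂) v = (T₂ * N₁) v := by rw [hcomm]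
    rw [Module.End.mul_apply, Module.End.mul_apply, hN, hN v, hφ, zero_smul, map_zero] at h1
    exact h1
  rw [hprod, LinearMap.trace_smulRight, LinearMap.comp_apply]
  rcases smul_eq_zero.1 hv with h0 | h0
  · exact h0
  · rw [h0, map_zero, map_zero]

/-- **A transvection commuting with `T₂` does not change the trace**: if `T₁ x = x + φ(x) • v` with `φ(v) = 0` and
`T₁ T₂ = T₂ T₁` then `tr(T₁ T₂) = tr(T₂)`. [cite: VoisinHodgeII2003, §3.2.1 Thm. 3.16 and Cor. 3.17] -/
theorem trace_mul_eq_trace_of_commute_of_transvection (T₁ T₂ : Module.End K V) (φ : Module.Dual K V) (v : V)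
    (hT : ∀ x, T₁ x = x + φ x • v) (hφ : φ v = 0) (hcomm : T₁ * T₂ = T₂ * T₁) :
    LinearMap.trace K V (T₁ * T₂) = LinearMap.trace K V T₂ := by
  have hN : ∀ x, (T₁ - 1) x = φ x • v := fun x => by
    rw [LinearMap.sub_apply, Module.End.one_apply, hT, add_sub_cancel_left]
  have hcomm' : (T₁ - 1) * T₂ = T₂ * (T₁ - 1) := by rw [sub_mul, mul_sub, hcomm, one_mul, mul_one]
  have h0 := trace_mul_eq_zero_of_commute_of_rankOne (T₁ - 1) T₂ φ v hN hφ hcomm'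
  rw [sub_mul, one_mul, map_sub, sub_eq_zero] at h0
  exact h0

/-- **A reflection commuting with an isometry `T₂` changes the trace by `±2`**: if `N₁ x = (c · B(x, v)) • v` with
`c · B(v, v) = −2` (so `1 + N₁` is the reflection in `v` for the symmetric form `B`), `T₂` preserves `B`, and
`N₁ T₂ = T₂ N₁`, then `T₂ v = ±v` and `tr(N₁ T₂) = c · B(T₂ v, v) ∈ {2, −2}`.
[cite: VoisinHodgeII2003, §3.2.1 Thm. 3.16, Cor. 3.17 and Rem. 3.21] -/
theorem trace_mul_eq_or_of_commute_of_reflection [CharZero K] (N₁ T₂ : Module.End K V) (B : V →ₗ[K] V →ₗ[K] K)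
    (c : K) (v : V) (hN : ∀ x, N₁ x = (c * B x v) • v) (hv : c * B v v = -2)
    (hiso : ∀ x y, B (T₂ x) (T₂ y) = B x y) (hcomm : N₁ * T₂ = T₂ * N₁) :
    LinearMap.trace K V (N₁ * T₂) = 2 ∨ LinearMap.trace K V (N₁ * T₂) = -2 := by
  -- `N₁ T₂ = (c B(T₂ ·, v)) • v` has trace `c B(T₂ v, v)`
  have hprod : N₁ * T₂ = (c • (B.flip v ∘ₗ T₂)).smulRight v := by
    refine LinearMap.ext fun x => ?_
    rw [Module.End.mul_apply, hN, LinearMap.smulRight_apply, LinearMap.smul_apply, LinearMap.comp_apply,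
      LinearMap.flip_apply, smul_eq_mul]
  have htr : LinearMap.trace K V (N₁ * T₂) = c * B (T₂ v) v := by
    rw [hprod, LinearMap.trace_smulRight, LinearMap.smul_apply, LinearMap.comp_apply, LinearMap.flip_apply, smul_eq_mul]
  -- `T₂ v = μ v` with `μ = -(c B(T₂ v, v))/2`
  have h2 : (2 : K) ≠ 0 := two_ne_zero
  have hTv : (2 : K) • T₂ v = -((c * B (T₂ v) v) • v) := by
    have h1 : (N₁ * T₂) v = (T₂ * N₁) v := by rw [hcomm]
    rw [Module.End.mul_apply, Module.End.mul_apply, hN, hN v, hv, map_smul, neg_smul] at h1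
    rw [h1, neg_neg]
  set μ : K := c * B (T₂ v) v with hμ
  have hTv' : T₂ v = (-(μ / 2)) • v := by
    have h1 : T₂ v = (2 : K)⁻¹ • ((2 : K) • T₂ v) := by rw [smul_smul, inv_mul_cancel₀ h2, one_smul]
    rw [h1, hTv, smul_neg, smul_smul, ← neg_smul]
    congr 1
    rw [div_eq_inv_mul]
  -- isometry: `μ² = 4`
  have hBvv : B v v ≠ 0 := by
    intro h0; rw [h0, mul_zero] at hv; exact h2 (by rw [← neg_eq_zero, ← hv])
  have hsq : (μ / 2) * (μ / 2) = 1 := by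
    have h1 := hiso v v
    simp only [hTv', map_smul, LinearMap.smul_apply, smul_eq_mul] at h1
    have h3 : (μ / 2 * (μ / 2) - 1) * B v v = 0 := by linear_combination h1
    rcases mul_eq_zero.1 h3 with h4 | h4
    · exact sub_eq_zero.1 h4
    · exact absurd h4 hBvv
  have hμ2 : μ = 2 ∨ μ = -2 := by
    have h5 : (μ / 2 - 1) * (μ / 2 + 1) = 0 := by ring_nf; linear_combination hsq
    rcases mul_eq_zero.1 h5 with h6 | h6
    · left; field_simp at h6; linear_combination h6
    · right; field_simp at h6; linear_combination h6
  rw [htr]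
  exact hμ2

end LinearAlgebra

/-! ### §2 The universal family: THE transports along a one-nodal circle and any other loop -/

section HodgeTheory

variable {n d : ℕ} {hn : 1 ≤ n} {hd : 1 ≤ d} {hU : IsCohomologicallyLocallyTrivialOn (family ℂ n d) Set.univ}
  {s : ComplexPoints (base ℂ n d)} {γ₁ : Path s s} {δ : bettiCohomology (fiberOver (family ℂ n d) s) n} {c : ℚ}

/-- **Odd fibre dimension: a one-nodal monodromy commuting with `T₂` leaves `tr(T₂)` unchanged; so a trace
discrepancy forces NON-COMMUTATION.** Given one-nodal Picard–Lefschetz data `(δ, c)` along `γ₁` (`n` odd, so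
`B(δ, δ) = 0` and THE transport is the transvection `x ↦ x + c B(x, δ) δ`), the rational transport `T₁` along `γ₁`
and any `T₂`: `tr(T₁ ≫ T₂) ≠ tr(T₂) ⟹ T₁ ≫ T₂ ≠ T₂ ≫ T₁`.
[cite: VoisinHodgeII2003, §3.2.1 Thm. 3.16 and Cor. 3.17] [cite: ArnoldGuseinzadeVarchenko2012, Part I §1.3] -/
theorem IsPicardLefschetzData.trans_ne_trans_of_odd_of_trace_ne (h : IsPicardLefschetzData n d 1 hn hd hU γ₁ ![δ] c)
    (hodd : Odd n)
    {T₁ T₂ : bettiCohomology (fiberOver (family ℂ n d) s) n ≃ₗ[ℚ] bettiCohomology (fiberOver (family ℂ n d) s) n}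
    (hT₁ : IsRatTransport (family ℂ n d) n hU (loopClassUniv n d γ₁) T₁)
    (htr : LinearMap.trace ℚ _ (T₁.trans T₂ : bettiCohomology (fiberOver (family ℂ n d) s) n →ₗ[ℚ]
        bettiCohomology (fiberOver (family ℂ n d) s) n) ≠
      LinearMap.trace ℚ _ (T₂ : bettiCohomology (fiberOver (family ℂ n d) s) n →ₗ[ℚ]
        bettiCohomology (fiberOver (family ℂ n d) s) n)) :
    T₁.trans T₂ ≠ T₂.trans T₁ := by
  haveI : Module.Finite ℚ (bettiCohomology (fiberOver (family ℂ n d) s) n) :=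
    BettiUniverse.finite ((isSmoothProjectiveFamily_family ℂ hn hd).isSmoothProjective s) n
  obtain ⟨-, -, ⟨T, hT, hTx⟩, -, -, hoddC⟩ := h
  have hTT : T₁ = T := LinearEquiv.ext fun v => ofRatClass_injective n ((hT₁ v).trans (hT v).symm)
  intro hcomm
  apply htr
  -- the linear functional `φ = c B(·, δ)` and `φ(δ) = 0`
  let hX : IsSmoothProjective n (fiberOver (family ℂ n d) s) := (isSmoothProjectiveFamily_family ℂ hn hd).isSmoothProjective s
  let φ : Module.Dual ℚ (bettiCohomology (fiberOver (family ℂ n d) s) n) :=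
    c • (BettiUniverse.tr hX (n + n) ∘ₗ (BettiUniverse.cup (fiberOver (family ℂ n d) s) n n).flip δ)
  have hφ : ∀ x, φ x = c * BettiUniverse.tr hX (n + n) (BettiUniverse.cup (fiberOver (family ℂ n d) s) n n x δ) :=
    fun x => rfl
  have hT1x : ∀ x, T₁.toLinearMap x = x + φ x • δ := fun x => by
    rw [LinearEquiv.coe_coe, hTT, hTx x, Fin.sum_univ_one, Matrix.cons_val_fin_one, hφ, smul_smul]
  have hφδ : φ δ = 0 := by
    have h0 := hoddC hodd 0
    simp only [Matrix.cons_val_fin_one] at h0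
    rw [hφ, h0, mul_zero]
  -- `T₁ ≫ T₂ = T₂ ∘ T₁` as linear maps; commute
  have hc1 : (T₁.trans T₂).toLinearMap = T₂.toLinearMap * T₁.toLinearMap := rfl
  have hc2 : (T₂.trans T₁).toLinearMap = T₁.toLinearMap * T₂.toLinearMap := rfl
  have hcommL : T₁.toLinearMap * T₂.toLinearMap = T₂.toLinearMap * T₁.toLinearMap := by
    rw [← hc1, ← hc2, hcomm]
  rw [hc1, ← hcommL]
  exact trace_mul_eq_trace_of_commute_of_transvection _ _ φ δ hT1x hφδ hcommL

/-- **Even fibre dimension: a one-nodal monodromy commuting with an isometry `T₂` changes `tr(T₂)` by `±2`; so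
`tr(T₁ ≫ T₂) − tr(T₂) ∉ {2, −2}` forces NON-COMMUTATION.** Here `c B(δ, δ) = −2` and THE transport along `γ₁` is the
reflection `x ↦ x + c B(x, δ) δ`. [cite: VoisinHodgeII2003, §3.2.1 Thm. 3.16, Cor. 3.17 and Rem. 3.21]
[cite: ArnoldGuseinzadeVarchenko2012, Part I §1.3] -/
theorem IsPicardLefschetzData.trans_ne_trans_of_even_of_trace_ne (h : IsPicardLefschetzData n d 1 hn hd hU γ₁ ![δ] c)
    (heven : Even n)
    {T₁ T₂ : bettiCohomology (fiberOver (family ℂ n d) s) n ≃ₗ[ℚ] bettiCohomology (fiberOver (family ℂ n d) s) n}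
    (hT₁ : IsRatTransport (family ℂ n d) n hU (loopClassUniv n d γ₁) T₁)
    (hiso : ∀ x y, BettiUniverse.tr ((isSmoothProjectiveFamily_family ℂ hn hd).isSmoothProjective s) (n + n)
        (BettiUniverse.cup (fiberOver (family ℂ n d) s) n n (T₂ x) (T₂ y)) =
      BettiUniverse.tr ((isSmoothProjectiveFamily_family ℂ hn hd).isSmoothProjective s) (n + n)
        (BettiUniverse.cup (fiberOver (family ℂ n d) s) n n x y))
    (htr₁ : LinearMap.trace ℚ _ (T₁.trans T₂ : bettiCohomology (fiberOver (family ℂ n d) s) n →ₗ[ℚ]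
        bettiCohomology (fiberOver (family ℂ n d) s) n) ≠
      LinearMap.trace ℚ _ (T₂ : bettiCohomology (fiberOver (family ℂ n d) s) n →ₗ[ℚ]
        bettiCohomology (fiberOver (family ℂ n d) s) n) + 2)
    (htr₂ : LinearMap.trace ℚ _ (T₁.trans T₂ : bettiCohomology (fiberOver (family ℂ n d) s) n →ₗ[ℚ]
        bettiCohomology (fiberOver (family ℂ n d) s) n) ≠
      LinearMap.trace ℚ _ (T₂ : bettiCohomology (fiberOver (family ℂ n d) s) n →ₗ[ℚ]
        bettiCohomology (fiberOver (family ℂ n d) s) n) - 2) :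
    T₁.trans T₂ ≠ T₂.trans T₁ := by
  haveI : Module.Finite ℚ (bettiCohomology (fiberOver (family ℂ n d) s) n) :=
    BettiUniverse.finite ((isSmoothProjectiveFamily_family ℂ hn hd).isSmoothProjective s) n
  obtain ⟨-, -, ⟨T, hT, hTx⟩, -, hevenC, -⟩ := h
  have hTT : T₁ = T := LinearEquiv.ext fun v => ofRatClass_injective n ((hT₁ v).trans (hT v).symm)
  intro hcomm
  let hX : IsSmoothProjective n (fiberOver (family ℂ n d) s) := (isSmoothProjectiveFamily_family ℂ hn hd).isSmoothProjective s
  let B : bettiCohomology (fiberOver (family ℂ n d) s) n →ₗ[ℚ] bettiCohomology (fiberOver (family ℂ n d) s) n →ₗ[ℚ] ℚ :=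
    (BettiUniverse.cup (fiberOver (family ℂ n d) s) n n).compr₂ (BettiUniverse.tr hX (n + n))
  have hB : ∀ x y, B x y = BettiUniverse.tr hX (n + n) (BettiUniverse.cup (fiberOver (family ℂ n d) s) n n x y) :=
    fun x y => rfl
  have hN : ∀ x, (T₁.toLinearMap - 1) x = (c * B x δ) • δ := fun x => by
    rw [LinearMap.sub_apply, Module.End.one_apply, LinearEquiv.coe_coe, hTT, hTx x, Fin.sum_univ_one,
      Matrix.cons_val_fin_one, hB, smul_smul, add_sub_cancel_left]
  have hv : c * B δ δ = -2 := by
    have h0 := (hevenC heven 0).1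
    simp only [Matrix.cons_val_fin_one] at h0
    rw [hB]; exact h0
  have hc1 : (T₁.trans T₂).toLinearMap = T₂.toLinearMap * T₁.toLinearMap := rfl
  have hc2 : (T₂.trans T₁).toLinearMap = T₁.toLinearMap * T₂.toLinearMap := rfl
  have hcommL : T₁.toLinearMap * T₂.toLinearMap = T₂.toLinearMap * T₁.toLinearMap := by
    rw [← hc1, ← hc2, hcomm]
  have hcommN : (T₁.toLinearMap - 1) * T₂.toLinearMap = T₂.toLinearMap * (T₁.toLinearMap - 1) := by
    rw [sub_mul, mul_sub, hcommL, one_mul, mul_one]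
  have hor := trace_mul_eq_or_of_commute_of_reflection (T₁.toLinearMap - 1) T₂.toLinearMap B c δ hN hv
    (fun x y => by rw [hB, hB]; exact hiso x y) hcommN
  rw [sub_mul, one_mul, map_sub, hcommL, ← hc1] at hor
  rcases hor with h1 | h1
  · exact htr₁ (by linear_combination h1)
  · exact htr₂ (by linear_combination h1)

end HodgeTheory

end Literature.AlgebraicGeometry.HodgeTheory

end
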